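import Mathlib.Analysis.SpecialFunctions.Complex.CircleAddChar
import Literature.AnabelianGeometry.EtaleTheta.Discharge.Sec4NonVacuityCoveringZ
import HarnessLib

/-!
# [EtTh] §4 over the GENUINE Kummer tower: deck transformations, integral exponents, `Π^tp_X ↠ ℤ ↠ ℤ/N`
# (consistency witness, part 10 — data)

S. Mochizuki, *The étale theta function and its Frobenioid-theoretic manifestations*, Publ. RIMS **45**
(2009) [MochizukiEtTh2009], §4: setting of Def 4.1 (PDF p.86), Prop 4.2 (iii) p.88 and its proof p.89
(ERRATUM E2 "over some tempered covering … `f` admits an `N`-th root"); [FrdI] Def 1.1 (ii) (monoids on `D`).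

CONSISTENCY WITNESS, TOY — the setting `ToyTower`, designed to REMOVE the two honest limits of this seat's
`ToyCov` (p427822) / `ToyCovZ` (p429761, p430083 `ToyCovZ.not_isMonoidOn_ratFnFunctor`): there the Kummer
tower was COLLAPSED to the one-object category `SingleObj ℕ+`, so every base arrow was an FSM-morphism,
[FrdI] Def 1.1 (ii) forced bijective pull-backs (hence divisible exponents), and all Galois groups were trivial.
HERE the base `D` is the genuine tower ("monomial functions on the Kummer tower of `𝔾_m/ℂ`"):
* objects `X_N` (`N ≥ 1`; the transitive `ℤ`-set `ℤ/N`), `Hom(X_M, X_N) = {t_N = ζ_N^a t_M^{M/N}}` = shifts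
  `a ∈ ℤ/N` when `N ∣ M` (`Base`, a `SmallCategory`): composition adds shifts, `Aut(X_N) = ℤ/N` (DECK
  TRANSFORMATIONS, `shiftIso`), covers of degree `> 1` are NOT monomorphisms, every arrow is epi, connected;
* `Φ(X_N) = ℚ_{≥0}·[0]` (perfect), pull-back `× (M/N)`; `B(X_N) = ℂˣ × t_N^ℤ` (INTEGRAL exponents, monoid
  type `ℤ`) with the honest pull-back `c·t_N^n ↦ c ζ_N^{an} · t_M^{(M/N) n}` (`twist`, `pullFn`, `fnFunctor`;
  functoriality = `ζ_M^{M/N} = ζ_N`, `toCircle_castHom`), divisor `c·t^n ↦ n·[0]` (`Toy.divHomQ`);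
* `Π^tp_X ↠ G_K` := abc-iut-L3's [SemiAnbd] Ex. 3.10 datum of the R78 χ-twisted root model of [EtTh] §1
  (`Π = Γ ⋊_χ G_{ℚ_p}`, `Γ = F̂₂ ×_Ẑ ℤ`: tempered, SLIM, Galois-countable — PROVED there,
  `SettingModel.nonempty_groupLevelData_curveχ_holds`), and **`Π^tp_X ↠ Aut_D(X_N) = ℤ/N`** := its loop
  quotient `Π^tp_X ↠ ℤ` (`(SettingModel.chiTwistData p).toZ`, surjective) followed by `ℤ ↠ ℤ/N` — every object
  Galois with a NON-TRIVIAL group hit by `Π^tp_X` (`galoisSurj_surjective`);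
* `A_⊙ := (X_1, 0)` (Frobenius-trivial), `(N,H)`-slot `True`; the `BiKummerSetting` through abc-iut-L2-t9's
  `mkOfModelCanonical`; the constants `c ∈ ℂˣ` as units `coefUnit` ([FrdI] Thm 5.2 (ii)).
Sequels (proof-only): `B` IS a monoid on `D` and `C` IS a Frobenioid; `N`-th roots of `t_M` exist ONLY on
`X_{NM}`; every object is `μ_N`-saturated; the six laws of the Prop 4.2 (iii)∧(iv) floor hold and the closers fire.
HONEST LIMITS: a toy (𝔾_m, not a Tate curve; trivial [FrdI] vocabularies; `(N,H)`-slot `True`; the Galois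
datum is borrowed from the §1 root model, only its quotient `Π^tp_X ↠ ℤ` acts); consistency ≠ faithfulness;
typed ≠ proved.  This file: DATA (`def`s are objects; no `Prop`-valued definition, no named fact; one
`SmallCategory` instance for the new base).  Nothing here bears on, or takes a side on, [IUTchIII] Cor. 3.12.
-/

noncomputable section

namespace Literature.AnabelianGeometry.EtaleTheta

open CategoryTheory Opposite Literature.AlgebraicGeometry.Frobenioids
open scoped NNRat

namespace ToyTower

/-! ## The base: finite connected covers in the Kummer tower of `𝔾_m` -/

/-- An object `X_N` of the Kummer tower: the cover `t ↦ t^N` of `𝔾_m/ℂ` (the transitive `ℤ`-set `ℤ/N`).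
[cite: MochizukiEtTh2009, Def 3.3 p.73] -/
structure Base : Type where
  /-- the level `N ≥ 1` of `X_N` -/
  lvl : ℕ+

namespace Base

/-- A morphism `X_M → X_N` (`N ∣ M`): `t_N = ζ_N^a · t_M^{M/N}`, recorded by its shift `a ∈ ℤ/N`.
[cite: MochizukiEtTh2009, Def 3.3 p.73] -/
@[ext] structure Hom (A B : Base) : Type where
  /-- the deck-transformation part `a ∈ ℤ/N` -/
  shift : ZMod B.lvl
  /-- `X_M → X_N` exists only when `N ∣ M` -/
  dvd : (B.lvl : ℕ) ∣ (A.lvl : ℕ)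

/-- The tower as a category: `X_L →(b) X_M →(a) X_N` has shift `(b mod N) + a`. [cite: MochizukiEtTh2009, Def 3.3 p.73] -/
instance : SmallCategory Base where
  Hom := Hom
  id A := ⟨0, dvd_rfl⟩
  comp f g := ⟨ZMod.castHom g.dvd _ f.shift + g.shift, g.dvd.trans f.dvd⟩
  id_comp f := Hom.ext (by
    change ZMod.castHom f.dvd _ 0 + f.shift = f.shift
    rw [map_zero, zero_add])
  comp_id {A B} f := Hom.ext (by
    change ZMod.castHom (dvd_rfl : (B.lvl : ℕ) ∣ B.lvl) _ f.shift + 0 = f.shift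
    rw [add_zero]
    exact RingHom.congr_fun (RingHom.ext_zmod (ZMod.castHom dvd_rfl (ZMod B.lvl)) (RingHom.id _)) f.shift)
  assoc {A B C E} f g h := Hom.ext (by
    change ZMod.castHom h.dvd _ (ZMod.castHom g.dvd _ f.shift + g.shift) + h.shift =
      ZMod.castHom (h.dvd.trans g.dvd) _ f.shift + (ZMod.castHom h.dvd _ g.shift + h.shift)
    rw [map_add, ← add_assoc]
    congr 2
    exact RingHom.congr_fun
      (RingHom.ext_zmod ((ZMod.castHom h.dvd (ZMod E.lvl)).comp (ZMod.castHom g.dvd (ZMod C.lvl)))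
        (ZMod.castHom (h.dvd.trans g.dvd) (ZMod E.lvl))) f.shift)

/-- Morphisms are determined by their shifts. [cite: MochizukiEtTh2009, Def 3.3 p.73] -/
theorem hom_ext {A B : Base} {f g : A ⟶ B} (h : f.shift = g.shift) : f = g := Hom.ext h

/-- The identity has shift `0`. [cite: MochizukiEtTh2009, Def 3.3 p.73] -/
@[simp] theorem id_shift (A : Base) : (𝟙 A : A ⟶ A).shift = 0 := rfl

/-- Shift of a composite. [cite: MochizukiEtTh2009, Def 3.3 p.73] -/
@[simp] theorem comp_shift {A B C : Base} (f : A ⟶ B) (g : B ⟶ C) :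
    (f ≫ g).shift = ZMod.castHom g.dvd _ f.shift + g.shift := rfl

/-- Cast along the identity divisibility is the identity. [folklore] -/
private theorem castHom_self_apply (B : Base) (x : ZMod B.lvl) :
    ZMod.castHom (dvd_rfl : (B.lvl : ℕ) ∣ B.lvl) (ZMod B.lvl) x = x :=
  RingHom.congr_fun (RingHom.ext_zmod (ZMod.castHom dvd_rfl (ZMod B.lvl)) (RingHom.id _)) x

/-- The degree `M/N` of `f : X_M → X_N`. [cite: MochizukiEtTh2009, Def 3.6 p.76] -/
def deg {A B : Base} (_f : A ⟶ B) : ℕ := (A.lvl : ℕ) / (B.lvl : ℕ)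

/-- `deg f · N = M`. [cite: MochizukiEtTh2009, Def 3.6 p.76] -/
theorem deg_mul_lvl {A B : Base} (f : A ⟶ B) : deg f * (B.lvl : ℕ) = A.lvl := Nat.div_mul_cancel f.dvd

/-- Degrees are positive. [cite: MochizukiEtTh2009, Def 3.6 p.76] -/
theorem deg_pos {A B : Base} (f : A ⟶ B) : 0 < deg f := Nat.div_pos (Nat.le_of_dvd A.lvl.pos f.dvd) B.lvl.pos

/-- `deg 𝟙 = 1`. [cite: MochizukiEtTh2009, Def 3.6 p.76] -/
@[simp] theorem deg_id (A : Base) : deg (𝟙 A) = 1 := Nat.div_self A.lvl.pos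

/-- Degrees multiply. [cite: MochizukiEtTh2009, Def 3.6 p.76] -/
theorem deg_comp {A B C : Base} (f : A ⟶ B) (g : B ⟶ C) : deg (f ≫ g) = deg f * deg g := by
  have h : deg (f ≫ g) * (C.lvl : ℕ) = (deg f * deg g) * (C.lvl : ℕ) := by
    rw [deg_mul_lvl, mul_assoc, deg_mul_lvl g, deg_mul_lvl f]
  exact Nat.eq_of_mul_eq_mul_right C.lvl.pos h

/-- The deck transformation `t_N ↦ ζ_N^a t_N` of `X_N`. [cite: MochizukiEtTh2009, Def 3.3 p.73] -/
def shiftIso (A : Base) (a : ZMod A.lvl) : A ≅ A where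
  hom := ⟨a, dvd_rfl⟩
  inv := ⟨-a, dvd_rfl⟩
  hom_inv_id := hom_ext (by rw [comp_shift, castHom_self_apply, add_neg_cancel, id_shift])
  inv_hom_id := hom_ext (by rw [comp_shift, castHom_self_apply, neg_add_cancel, id_shift])

/-- `Aut(X_N) = ℤ/N`: every automorphism is a deck transformation. [cite: MochizukiEtTh2009, Def 3.3 p.73] -/
theorem eq_shiftIso {A : Base} (σ : A ≅ A) : σ = shiftIso A σ.hom.shift := Iso.ext (hom_ext rfl)

/-- The deck transformations as a homomorphism `ℤ/N → Aut(X_N)`. [cite: MochizukiEtTh2009, Def 3.3 p.73] -/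
def shiftHom (A : Base) : Multiplicative (ZMod A.lvl) →* Aut A where
  toFun a := shiftIso A (Multiplicative.toAdd a)
  map_one' := Iso.ext (hom_ext rfl)
  map_mul' a b := Iso.ext (hom_ext (by
    change Multiplicative.toAdd (a * b) =
      ZMod.castHom (dvd_rfl : (A.lvl : ℕ) ∣ A.lvl) _ (Multiplicative.toAdd b) + Multiplicative.toAdd a
    rw [castHom_self_apply, toAdd_mul, add_comm]))

/-- `ℤ/N → Aut(X_N)` is onto. [cite: MochizukiEtTh2009, Def 3.3 p.73] -/
theorem shiftHom_surjective (A : Base) : Function.Surjective (shiftHom A) := fun σ =>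
  ⟨Multiplicative.ofAdd σ.hom.shift, (eq_shiftIso σ).symm⟩

/-- Every morphism of the tower is an epimorphism. [cite: MochizukiEtTh2009, Def 3.6 p.76] -/
theorem epi {A B : Base} (f : A ⟶ B) : Epi f := ⟨fun _ _ e => hom_ext (add_left_cancel (congrArg Hom.shift e :))⟩

/-- The structure map `X_N → X_1`. [cite: MochizukiEtTh2009, Def 3.3 p.73] -/
def toOne (A : Base) : A ⟶ ⟨1⟩ := ⟨0, one_dvd _⟩

/-- The tower is connected. [cite: MochizukiEtTh2009, Def 3.6 p.76] -/
theorem isConnected : IsConnected Base := by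
  haveI : Nonempty Base := ⟨⟨1⟩⟩
  exact zigzag_isConnected fun A B => (Zigzag.of_hom (toOne A)).trans (Zigzag.of_inv (toOne B))

end Base

open Base

/-- The trivial [FrdI] category vocabulary on the tower. [cite: MochizukiEtTh2009, Def 3.6 p.77] -/
def catVocab : FrdICatStub.{0, 0, 0} Base where
  IsDivisorialOn _ := True
  IsRational _ := True
  IsStrictlyRational _ := True

/-! ## Pull-back of divisors and of monomial functions along the tower -/

/-- `X_N ↦ M`, pull-back along a morphism of degree `k` the `k`-th power map. [cite: MochizukiEtTh2009, Def 3.3 p.73] -/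
def powFunctor (M : Type) [CommMonoid M] : Baseᵒᵖ ⥤ CommMonCat.{0} where
  obj _ := CommMonCat.of M
  map f := CommMonCat.ofHom (powMonoidHom (deg f.unop))
  map_id A := by
    apply CommMonCat.hom_ext
    ext x
    change x ^ deg (𝟙 A.unop) = x
    rw [deg_id, pow_one]
  map_comp f g := by
    apply CommMonCat.hom_ext
    ext x
    change x ^ deg (g.unop ≫ f.unop) = (x ^ deg f.unop) ^ deg g.unop
    rw [deg_comp, mul_comm, pow_mul]

/-- Monomial functions `c · t_N^n` on `X_N`: `ℂˣ × t^ℤ`. [cite: MochizukiEtTh2009, Def 3.3 p.73] -/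
abbrev Fn : Type := ℂˣ × Multiplicative ℤ

/-- The root of unity `ζ_N^{a n}` picked up by `t_N^n` under `t_N ↦ ζ_N^a t_M^{M/N}`, as a character of `n`.
[cite: MochizukiEtTh2009, Def 3.3 p.73] -/
def twist {A B : Base} (f : A ⟶ B) : Multiplicative ℤ →* ℂˣ :=
  haveI : NeZero ((B.lvl : ℕ)) := ⟨B.lvl.ne_zero⟩
  { toFun := fun n => Circle.toUnits (ZMod.toCircle (((Multiplicative.toAdd n : ℤ) : ZMod B.lvl) * f.shift))
    map_one' := by rw [toAdd_one, Int.cast_zero, zero_mul, AddChar.map_zero_eq_one, map_one]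
    map_mul' := fun m n => by rw [toAdd_mul, Int.cast_add, add_mul, AddChar.map_add_eq_mul, map_mul] }

/-- Value of `twist`. [cite: MochizukiEtTh2009, Def 3.3 p.73] -/
theorem twist_apply {A B : Base} (f : A ⟶ B) (n : Multiplicative ℤ) :
    twist f n = (haveI : NeZero ((B.lvl : ℕ)) := ⟨B.lvl.ne_zero⟩
      Circle.toUnits (ZMod.toCircle (((Multiplicative.toAdd n : ℤ) : ZMod B.lvl) * f.shift))) := rfl

/-- Change of level for the circle character: for `d ∣ m`, `e((x mod d)/d) = e(((m/d)·x)/m)`. [folklore] -/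
private theorem toCircle_castHom {m d : ℕ} [NeZero m] [NeZero d] (h : d ∣ m) (x : ZMod m) :
    (ZMod.toCircle (ZMod.castHom h (ZMod d) x) : ℂ) = ZMod.toCircle (((m / d : ℕ) : ZMod m) * x) := by
  obtain ⟨z, rfl⟩ := ZMod.intCast_surjective x
  have hd : (d : ℂ) ≠ 0 := Nat.cast_ne_zero.mpr (NeZero.ne d)
  have hm : (m : ℂ) ≠ 0 := Nat.cast_ne_zero.mpr (NeZero.ne m)
  have hcast : ((m / d : ℕ) : ZMod m) * (z : ZMod m) = (((m / d : ℕ) * z : ℤ) : ZMod m) := by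
    rw [Int.cast_mul, Int.cast_natCast]
  rw [map_intCast, hcast, ZMod.toCircle_intCast, ZMod.toCircle_intCast, Int.cast_mul, Int.cast_natCast,
    Nat.cast_div h hd]
  congr 1
  field_simp

/-- `ζ` along `X_L →(b) X_M →(a) X_N`: `ζ_N^{((M/N)·b + a) n} = ζ_N^{a n} · ζ_M^{b (M/N) n}` (`ζ_M^{M/N} = ζ_N`).
[cite: MochizukiEtTh2009, Def 3.3 p.73] -/
theorem twist_comp {A B C : Base} (ψ : A ⟶ B) (φ : B ⟶ C) (n : Multiplicative ℤ) :
    twist (ψ ≫ φ) n = twist φ n * twist ψ (n ^ deg φ) := by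
  haveI : NeZero ((B.lvl : ℕ)) := ⟨B.lvl.ne_zero⟩
  haveI : NeZero ((C.lvl : ℕ)) := ⟨C.lvl.ne_zero⟩
  rw [twist_apply, twist_apply, twist_apply, ← map_mul, comp_shift, mul_add, AddChar.map_add_eq_mul,
    mul_comm (ZMod.toCircle _) (ZMod.toCircle _)]
  congr 2
  apply Circle.ext
  have h1 : ((Multiplicative.toAdd n : ℤ) : ZMod C.lvl) * ZMod.castHom φ.dvd (ZMod C.lvl) ψ.shift =
      ZMod.castHom φ.dvd (ZMod C.lvl) (((Multiplicative.toAdd n : ℤ) : ZMod B.lvl) * ψ.shift) := by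
    rw [map_mul, map_intCast]
  rw [h1, toCircle_castHom φ.dvd, toAdd_pow, nsmul_eq_mul, Int.cast_mul, Int.cast_natCast, ← mul_assoc]
  rfl

/-- **Pull-back of monomial functions along `f : X_M → X_N`**, `t_N = ζ_N^a t_M^{M/N}`:
`c · t_N^n ↦ c ζ_N^{an} · t_M^{(M/N) n}`. [cite: MochizukiEtTh2009, Def 3.3 p.73] -/
def pullFn {A B : Base} (f : A ⟶ B) : Fn →* Fn :=
  (MonoidHom.fst ℂˣ (Multiplicative ℤ) * (twist f).comp (MonoidHom.snd _ _)).prod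
    ((powMonoidHom (deg f)).comp (MonoidHom.snd _ _))

/-- Value of `pullFn`. [cite: MochizukiEtTh2009, Def 3.3 p.73] -/
@[simp] theorem pullFn_apply {A B : Base} (f : A ⟶ B) (x : Fn) : pullFn f x = (x.1 * twist f x.2, x.2 ^ deg f) := rfl

/-- Pull-back along the identity. [cite: MochizukiEtTh2009, Def 3.3 p.73] -/
theorem pullFn_id (A : Base) (x : Fn) : pullFn (𝟙 A) x = x := by
  haveI : NeZero ((A.lvl : ℕ)) := ⟨A.lvl.ne_zero⟩
  rw [pullFn_apply, deg_id, pow_one, twist_apply, id_shift, mul_zero, AddChar.map_zero_eq_one, map_one, mul_one]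

/-- Pull-back along a composite. [cite: MochizukiEtTh2009, Def 3.3 p.73] -/
theorem pullFn_comp {A B C : Base} (ψ : A ⟶ B) (φ : B ⟶ C) (x : Fn) :
    pullFn (ψ ≫ φ) x = pullFn ψ (pullFn φ x) := by
  rw [pullFn_apply, pullFn_apply, pullFn_apply, twist_comp, mul_assoc, deg_comp, mul_comm (deg ψ), pow_mul]

/-- **`B₀ = B₀^Λ`: monomial functions on the tower, as a functor** (deck transformations ACT).
[cite: MochizukiEtTh2009, Def 3.3 p.73] -/
def fnFunctor : Baseᵒᵖ ⥤ CommMonCat.{0} where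
  obj _ := CommMonCat.of Fn
  map f := CommMonCat.ofHom (pullFn f.unop)
  map_id A := by
    apply CommMonCat.hom_ext
    ext x <;> simp only [unop_id, CommMonCat.hom_ofHom, pullFn_id, CommMonCat.hom_id, MonoidHom.id_apply]
  map_comp f g := by
    apply CommMonCat.hom_ext
    apply MonoidHom.ext
    intro x
    change pullFn (g.unop ≫ f.unop) x = pullFn g.unop (pullFn f.unop x)
    exact pullFn_comp _ _ x

/-- On groupifications the `N`-th power map induces the `N`-th power map. [folklore] -/
private theorem gpMap_powMonoidHom (M : Type) [CommMonoid M] (N : ℕ) :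
    gpMap (powMonoidHom N : M →* M) = powMonoidHom N := by
  apply Algebra.GrothendieckGroup.lift.symm.injective
  rw [Algebra.GrothendieckGroup.lift_symm_apply, Algebra.GrothendieckGroup.lift_symm_apply]
  ext m
  change gpMap (powMonoidHom N) (Algebra.GrothendieckGroup.of m) = Algebra.GrothendieckGroup.of m ^ N
  rw [gpMap_of, powMonoidHom_apply, map_pow]

/-- **Def 3.3 (iii) data of the tower**: `Φ₀ = ℚ_{≥0}·[0]`, `B₀ = ℂˣ × t^ℤ`, divisor `c·t^n ↦ n·[0]`, `F₀ = B₀`,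
everything non-cuspidal. [cite: MochizukiEtTh2009, Def 3.3 p.73] -/
def divisorMonoids : DivisorMonoids.{0, 0, 0} Base where
  Φ₀ := powFunctor (Multiplicative ℚ≥0)
  B₀ := fnFunctor
  isUnit_B₀ _ b := by
    change IsUnit (M := Fn) b
    exact Group.isUnit _
  div₀ _ := Toy.divHomQ.comp (MonoidHom.snd _ _)
  div₀_natural f b := by
    change Toy.divHomQ (b.2 ^ deg f.unop) =
      gpMap (powMonoidHom (deg f.unop) : Multiplicative ℚ≥0 →* Multiplicative ℚ≥0) (Toy.divHomQ b.2)
    rw [gpMap_powMonoidHom, map_pow]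
    rfl
  F₀ _ := ⊤
  F₀_map _ _ _ := trivial
  ncsp₀ _ := ⊤
  csp₀ _ := ⊥
  ncsp₀_map _ _ _ := trivial
  csp₀_map f x hx := by
    rw [Submonoid.mem_bot] at hx ⊢
    rw [hx, map_one]
  existsUnique_ncsp_csp _ x := by
    refine ⟨(⟨x, trivial⟩, ⟨1, Submonoid.mem_bot.mpr rfl⟩), mul_one x, ?_⟩
    rintro ⟨a, c⟩ h
    have hc : c.1 = 1 := Submonoid.mem_bot.mp c.2
    have ha : a.1 = x := by
      have h' : a.1 * c.1 = x := h
      rwa [hc, mul_one] at h'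
    exact Prod.ext (Subtype.ext ha) (Subtype.ext hc)

/-- **Def 3.6 (i) data of the tower** (`Λ = ℤ`, `Φ₀^ℝ = Φ₀`, `B₀^Λ = B₀`, `F₀^Λ = B₀`, `ℝ·Φ₀^cnst =` everything).
[cite: MochizukiEtTh2009, Def 3.6 p.76] -/
def realified : RealifiedDivisorMonoids (D₀ := Base) Toy.monoidVocab where
  toDivisorMonoids := divisorMonoids
  Λ := MonoidType.Z
  ΦR := powFunctor (Multiplicative ℚ≥0)
  toR _ := MonoidHom.id _
  toR_natural _ _ := rfl
  isRealification _ := trivial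
  BΛ := fnFunctor
  isUnit_BΛ _ b := by
    change IsUnit (M := Fn) b
    exact Group.isUnit _
  divΛ _ := Toy.divHomQ.comp (MonoidHom.snd _ _)
  divΛ_natural f b := by
    change Toy.divHomQ (b.2 ^ deg f.unop) =
      gpMap (powMonoidHom (deg f.unop) : Multiplicative ℚ≥0 →* Multiplicative ℚ≥0) (Toy.divHomQ b.2)
    rw [gpMap_powMonoidHom, map_pow]
    rfl
  FΛ _ := ⊤
  FΛ_map _ _ _ := trivial
  cnstR _ := ⊤
  cnstR_map _ _ _ := trivial
  divΛ_mem_cnstR _ _ _ := trivial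
  cnstR_root _ _ _ _ := trivial
  cnst_le_cnstR _ _ _ := trivial
  ncspR _ := ⊤
  cspR _ := ⊥
  toR_ncsp _ _ _ := trivial
  toR_csp _ _ hx := hx

/-- **Def 3.6 (ii), the tower tempered Frobenioid**: `D → D₀` the identity, `Φ = Φ^{ℝ-log} = ℚ_{≥0}` (perfect),
`Φ^{bs-fld} = ℚ_{≥0}` monoprime, `t = 1·t¹ ∈ F` with divisor `[0] ≠ 0`. [cite: MochizukiEtTh2009, Def 3.6 p.77] -/
def temperedFrobenioid : TemperedFrobenioid realified Base catVocab where
  isConnected := Base.isConnected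
  isTotallyEpimorphic := ⟨fun f => Base.epi f⟩
  base := 𝟭 _
  Φ := ⟨fun _ => ⊤, fun _ _ _ => trivial⟩
  isGroupSaturated A := (isGroupSaturated_iff' _).2 fun _ _ _ _ _ _ => trivial
  isPerfFactorial _ := trivial
  isDivisorialOn := trivial
  isMonoprime_bsFld A := Toy.isMonoprime_of_eq_top_nnrat
    (eq_top_iff.2 fun x _ => Submonoid.mem_inf.2 ⟨Submonoid.mem_top x,
      (Subgroup.mem_top (Algebra.GrothendieckGroup.of x) :
        Algebra.GrothendieckGroup.of x ∈ (⊤ : Subgroup (Algebra.GrothendieckGroup (Multiplicative ℚ≥0))))⟩)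
  exists_FΛ_div_ne A := ⟨((1 : ℂˣ), Multiplicative.ofAdd (1 : ℤ)), trivial,
    (Multiplicative.ofAdd (1 : ℚ≥0) : Multiplicative ℚ≥0), trivial, (1 : Multiplicative ℚ≥0), trivial,
    fun h => one_ne_zero (Multiplicative.ofAdd.injective h), by
      change Toy.divHomQ (Multiplicative.ofAdd 1) =
        Algebra.GrothendieckGroup.of (M := Multiplicative ℚ≥0) (Multiplicative.ofAdd 1) /
          Algebra.GrothendieckGroup.of (M := Multiplicative ℚ≥0) 1
      rw [Toy.divHomQ_ofAdd_one, (Algebra.GrothendieckGroup.of (M := Multiplicative ℚ≥0)).map_one, div_one]⟩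

/-- "whose monoid type is `ℤ`". [cite: MochizukiEtTh2009, Def 4.1 p.86] -/
theorem temperedFrobenioid_monoidType : temperedFrobenioid.monoidType = MonoidType.Z := rfl

/-- "whose divisor monoid `Φ` is perfect": `Φ(X_N) = ℚ_{≥0}`. [cite: MochizukiEtTh2009, Def 4.1 p.86] -/
theorem temperedFrobenioid_isPerfect (A : Baseᵒᵖ) : IsPerfect (temperedFrobenioid.Φ.carrier A) :=
  isPerfect_of_mulEquiv_nnrat (N := ↥(⊤ : Submonoid (Multiplicative ℚ≥0))) Submonoid.topEquiv

/-- `B` is objectwise group-like. [cite: MochizukiEtTh2009, Def 3.6 p.77] -/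
theorem ratFnFunctor_isGroupLike : Objectwise (fun M _ => IsGroupLike M) temperedFrobenioid.ratFnFunctor :=
  temperedFrobenioid.ratFnFunctor_isGroupLike realified.isUnit_BΛ

end ToyTower

end Literature.AnabelianGeometry.EtaleTheta

end
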